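import Summits.ResolutionOfSingularities.ResolutionOfSingularities.Theorems.HilbertSamuelEliminationSigmaMaxModificationsCorridor3SigmaCyclePlusScope
import Summits.ResolutionOfSingularities.ResolutionOfSingularities.Theorems.HilbertSamuelEliminationSigmaMaxModificationsCorridor3SigmaStrataLineages
import Summits.ResolutionOfSingularities.ResolutionOfSingularities.Theorems.HilbertSamuelEliminationSigmaMaxModificationsCorridor3WLadderStrataBirthsMovingDefs
import Summits.ResolutionOfSingularities.ResolutionOfSingularities.Theorems.HilbertSamuelEliminationSigmaMaxModificationsCorridor3MovingCompactnessLeastLabel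
import Summits.ResolutionOfSingularities.ResolutionOfSingularities.Theorems.HilbertSamuelEliminationCampaignW42TertiaryStrictTransformParts
import HarnessLib

/-!
# [OURS · L1 W4.2] σ-LAYER — Ω-TRANSPORT brick 2b: LABEL PARTS along Ω⁺-runs — the replayed subscheme stays INSIDE its label part,
# births lie over the centre, the Ω⁺ END centre lies in the treated part, and the SANDWICH of a moving birth (D13's host) over Ω⁺

Crux chain w42 (`SigmaMaxModifications`, stmt-ResolutionOfSingularities-18506; conjunct `SigmaMaxModificationsCorridor3`,
stmt-ResolutionOfSingularities-19249), res-L1-w42-plan-1 RULING v3.14-12 (BR-6) / v3.14-14 (DL) «Ω-transports of the W-low rows — 040».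
Typer res-type-040 (gen 18). OURS (cell res-hironaka, slot W4.2); NOT statements of H. Hironaka's manuscript [Hironaka2017] nor of
[CossartJannsenSaito2020]; AI-drafted, weaker than expert review. Every `theorem` is PROVED; this file is def-free. Helper file
`--supports stmt-ResolutionOfSingularities-19249` (counted 0).

## The point of this brick

Under the END rule Ω⁺ (`IsCanonicalStepΩplus`, p523517) the admissible stage oracle may name WHOLE REGULAR COMPONENTS of the treated part as
centres, so the CJS identity «replayed subscheme = label part» (`CycleInv.pending`, p504439; the `⊆`-half of the label calculus
`CampaignW42.next_part_eq_strictTransformSet` needs «no label-`j` component inside `V(C)`») FAILS for Ω⁺ (a swallowed component may be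
dominated by an exceptional component, which inherits its label). The INCLUSION «replayed subscheme ⊆ label part» survives — the `⊇`-half
holds for EVERY centre (`strictTransformSet_part_subset_next_part`) — and is all the births / host arguments use.

## Contents (namespace `…Theorems.SigmaMaxModificationsCorridor3.Sigma`)

* §1 ONE BLOW-UP, strategy-free: `strictTransformSet_part_subset_next_part` (label calculus, `⊇`-half as an inclusion, any centre, any
  label); `subset_preimage_support_of_not_mem_componentsIn` (a component upstairs dominating no component downstairs lies over `V(C)` —
  the topological core of stub-4's `StepProjection.subset_preimage_support_of_not_mem`, p505133, stated once for a bare blow-up).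
* §2 ALONG Ω⁺-RUNS (σ = `Strategy.ofStageOraclePlus ω`, `ω` Ω⁺-admissible, `ν ≠ Φ^{(N)}`, under `CycleInvPlus` p524819):
  `CycleInvPlus.isClosed_hsStratum`; the PART INVARIANT `range_hom_subset_part_stepΩplus` / `_of_reachesΩplus` / `_chainΩplus`
  («inside a cycle the replayed subscheme lies in the label part of the cycle's label»); BIRTHS LIE OVER THE CENTRE
  `StepProjectionσ.subset_preimage_support_of_not_mem_Ωplus`, `isBlownUpσ_of_birth_Ωplus`; the END CENTRE
  `support_subset_part_of_next_none_Ωplus` (functional `ω`: at a step into a state between cycles the centre is `V(range φ) ⊆ Y^{(j)}`,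
  `j` the treated label — port of stub-4's `support_eq_part_of_next_none` with `=` weakened to `⊆`); the SANDWICH
  `Moving.IsMovingBirthAt.exists_host_Ωplus` and `not_isMovingBirthAt_of_forall_not_hasSandwichAt_Ωplus` (ports of res-type-040's
  p517068 §1 with the clause «host ⊆ centre» dropped — it is not needed by the D13 reduction and is false for Ω⁺ in general).

References: CJS LNM 2270 Rem. 6.29 (1) pp. 91–92 [CossartJannsenSaito2020]; Görtz–Wedhorn I (13.19), Prop. 13.91 (3) [GortzWedhorn2020]; tree
`…CampaignW42TertiaryStrictTransformParts`, `…TertiaryInStratum`, `…MovingCompactnessLeastLabel` (`exists_component_dominating_of_notMem_support`),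
`…WLadderStrataBirths` (p505133), `…WLadderStrataBirthsMovingDefs` (p517068), `…SigmaCyclePlusDefs/Package/Scope` (p523517/p524329/p524819).
-/

noncomputable section

set_option linter.dupNamespace false

open CategoryTheory AlgebraicGeometry TopologicalSpace Topology
open Summit.ResolutionOfSingularities.ResolutionOfSingularities.Theorems.CampaignW42
open Literature.AlgebraicGeometry.Resolution Literature.RingTheory.HilbertSamuel
open Summit.ResolutionOfSingularities.ResolutionOfSingularities.Theorems.SigmaMaxModificationsCorridor3
open Summit.ResolutionOfSingularities.ResolutionOfSingularities.Theorems.SigmaMaxModificationsCorridor3.Moving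
open Summit.ResolutionOfSingularities.ResolutionOfSingularities.Cruxes.SigmaMaxModifications.MovingCompactnessLine
  (exists_component_dominating_of_notMem_support)

namespace Summit.ResolutionOfSingularities.ResolutionOfSingularities.Theorems.SigmaMaxModificationsCorridor3.Sigma

universe u

/-! ## §1. One blow-up: the `⊇`-half of the label calculus as an inclusion, and births over the centre -/

/-- **THE STRICT TRANSFORM OF THE LABEL-`j` PART LIES IN THE NEXT LABEL-`j` PART — for EVERY centre.** Data: `π : Bl_C(W) → W`; closed
`Y ⊆ W` and `Y' ⊆ Bl_C(W)` with `π(Y') ⊆ Y`, finitely many components upstairs, the strict transform of every subset of `Y` inside `Y'`.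
Then `closure π⁻¹(Y^{(j)} ∖ V(C)) ⊆ (Y')^{(j)}`: a point over `Y^{(j)} ∖ V(C)` lies on a component upstairs DOMINATING a label-`j`
component, which inherits the label (`Labelling.next`). (The `⊆`-half of `next_part_eq_strictTransformSet` needs «no label-`j` component
inside `V(C)`»; this half does not.) [cite: CossartJannsenSaito2020, Rem. 6.29 (1)] [cite: GortzWedhorn2020, Prop. 13.91 (3), (13.19) p. 414] -/
theorem strictTransformSet_part_subset_next_part {W : Scheme.{u}} (C : W.IdealSheafData) (L : Labelling W) {Y : Set W}
    (hY : IsClosed Y) {Y' : Set ↥(blowup C)} (hY' : IsClosed Y') (hfin' : (componentsIn Y').Finite)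
    (hπY' : (blowup.π C).base '' Y' ⊆ Y)
    (hST : ∀ T, T ⊆ Y → strictTransformSet (blowup.π C) (C.support : Set W) T ⊆ Y') (j : ℕ) :
    strictTransformSet (blowup.π C) (C.support : Set W) (L.part Y j) ⊆ (L.next Y C).part Y' j := by
  refine closure_minimal ?_ ((L.next Y C).isClosed_part hY' hfin' j)
  intro y hy
  have hyP : (blowup.π C).base y ∈ L.part Y j := hy.1
  have hyE : (blowup.π C).base y ∉ (C.support : Set W) := hy.2
  obtain ⟨Z, hZ, hlab, hyZ⟩ := (L.mem_part_iff Y j _).mp hyP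
  obtain ⟨Z₁, hZ₁, hyZ₁, hdom⟩ := exists_component_dominating_of_notMem_support C hY hY' hfin' hπY' hST hZ hyZ hyE
  have hmem : closure (blowup.π C '' Z₁) ∈ componentsIn Y := hdom ▸ hZ
  refine ((L.next Y C).mem_part_iff Y' j y).mpr ⟨Z₁, hZ₁, ?_, hyZ₁⟩
  rw [L.next_label_of_mem C hmem, hdom, hlab]

/-- **A COMPONENT UPSTAIRS DOMINATING NO COMPONENT DOWNSTAIRS LIES OVER THE CENTRE** (topological core of «births lie over the centre»,
stub-4 p505133, for a bare blow-up). Data as above plus finitely many components downstairs; `Z'` a component of `Y'` with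
`closure π(Z') ∉ componentsIn Y`. Then `Z' ⊆ π⁻¹ V(C)`: otherwise `Z'` is the strict transform of the component `closure π(Z')` of `Y`
(off `V(C)` the blow-up is an isomorphism). [cite: CossartJannsenSaito2020, Rem. 6.29 (1), p. 92] [cite: GortzWedhorn2020, Prop. 13.91 (3), (13.19) p. 414] -/
theorem subset_preimage_support_of_not_mem_componentsIn {W : Scheme.{u}} (C : W.IdealSheafData) {Y : Set W}
    (hY : IsClosed Y) (hfin : (componentsIn Y).Finite) {Y' : Set ↥(blowup C)} (hY' : IsClosed Y')
    (hfin' : (componentsIn Y').Finite) (hπY' : (blowup.π C).base '' Y' ⊆ Y)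
    (hST : ∀ T, T ⊆ Y → strictTransformSet (blowup.π C) (C.support : Set W) T ⊆ Y')
    {Z' : Set ↥(blowup C)} (hZ' : Z' ∈ componentsIn Y') (hnot : closure (blowup.π C '' Z') ∉ componentsIn Y) :
    Z' ⊆ (blowup.π C).base ⁻¹' (C.support : Set W) := by
  -- adapted from stub-4's `StepProjection.subset_preimage_support_of_not_mem` (…WLadderStrataBirths, p505133)
  haveI : IsIso (blowup.π C ∣_ ⟨(C.support : Set W)ᶜ, C.support.isClosed.isOpen_compl⟩) :=
    (blowup.isBlowup C).isIso_compl
  rw [← not_not (a := Z' ⊆ _)]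
  intro hsub
  apply hnot
  have hne : (Z' ∩ ((blowup.π C).base ⁻¹' (C.support : Set W))ᶜ).Nonempty := by
    rw [← Set.sdiff_eq, Set.nonempty_iff_ne_empty, Ne, Set.sdiff_eq_empty]
    exact hsub
  have hZ'irr : IsIrreducible Z' := componentsIn.isIrreducible hZ'
  have hEπ : IsClosed ((blowup.π C).base ⁻¹' (C.support : Set W)) :=
    C.support.isClosed.preimage (blowup.π C).continuous
  -- `D = closure π(Z')` is irreducible, closed, inside `Y`, hence inside a component `Zc` of `Y`
  have hDirr : IsIrreducible (closure (blowup.π C '' Z')) :=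
    (hZ'irr.image _ (blowup.π C).continuous.continuousOn).closure
  have hDY : closure (blowup.π C '' Z') ⊆ Y :=
    closure_minimal ((Set.image_mono (componentsIn.subset hZ')).trans hπY') hY
  obtain ⟨Zc, hZc, hDZc⟩ := exists_componentsIn_superset hY hfin hDirr hDY
  -- `Zc ⊄ V(C)`
  obtain ⟨z', hz'Z, hz'E⟩ := hne
  have hZcC : ¬ Zc ⊆ (C.support : Set W) := fun hsub' =>
    hz'E (hsub' (hDZc (subset_closure ⟨z', hz'Z, rfl⟩)))
  -- the strict transform of `Zc` is irreducible, inside `Y'`, inside a component `Z₂`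
  have hTirr : IsIrreducible (strictTransformSet (blowup.π C) (C.support : Set W) Zc) :=
    isIrreducible_strictTransformSet_of_not_subset C (componentsIn.isIrreducible hZc) hZcC
  have hTY' : strictTransformSet (blowup.π C) (C.support : Set W) Zc ⊆ Y' := hST Zc (componentsIn.subset hZc)
  obtain ⟨Z₂, hZ₂, hTZ₂⟩ := exists_componentsIn_superset hY' hfin' hTirr hTY'
  -- `Z' ⊆ strict transform of `Zc`
  have hZ'T : Z' ⊆ strictTransformSet (blowup.π C) (C.support : Set W) Zc := by
    have h1 : Z' ⊆ closure (Z' ∩ ((blowup.π C).base ⁻¹' (C.support : Set W))ᶜ) :=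
      subset_closure_inter_of_isPreirreducible_of_isOpen hZ'irr.isPreirreducible hEπ.isOpen_compl ⟨z', hz'Z, hz'E⟩
    refine h1.trans (closure_mono ?_)
    rintro w ⟨hwZ, hwE⟩
    exact ⟨hDZc (subset_closure ⟨w, hwZ, rfl⟩), hwE⟩
  -- `Z' = Z₂` by maximality, so `Z'` IS the strict transform of `Zc`
  have hZ₂Z' : Z₂ ⊆ Z' :=
    (mem_componentsIn_iff.mp hZ').2.2 Z₂ (componentsIn.subset hZ₂) (componentsIn.isIrreducible hZ₂) (hZ'T.trans hTZ₂)
  -- `closure π(Z') = Zc`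
  have hsub2 : Zc ⊆ closure (blowup.π C '' Z') := by
    have hd : Zc ⊆ closure (Zc ∩ (C.support : Set W)ᶜ) :=
      subset_closure_inter_of_isPreirreducible_of_isOpen (componentsIn.isIrreducible hZc).isPreirreducible
        C.support.isClosed.isOpen_compl ⟨(blowup.π C).base z', hDZc (subset_closure ⟨z', hz'Z, rfl⟩), hz'E⟩
    refine hd.trans (closure_mono ?_)
    rintro w ⟨hwZc, hwE⟩
    obtain ⟨x, hx⟩ := exists_apply_eq_of_isIso_morphismRestrict (blowup.π C) ⟨(C.support : Set W)ᶜ, _⟩ hwE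
    refine ⟨x, hZ₂Z' (hTZ₂ (strictTransformSet.preimage_diff_subset (blowup.π C) (C.support : Set W) Zc ?_)), hx⟩
    show (blowup.π C).base x ∈ Zc \ (C.support : Set W)
    rw [show (blowup.π C).base x = w from hx]
    exact ⟨hwZc, hwE⟩
  have heq : closure (blowup.π C '' Z') = Zc :=
    Set.Subset.antisymm ((mem_componentsIn_iff.mp hZc).2.2 _ hDY hDirr hsub2) hsub2
  rw [heq]
  exact hZc

/-! ## §2. Along Ω⁺-runs -/

section Omega

variable {ω : StageOracle.{u}} {N : ℕ} {ν : ℕ → ℕ} {k : Type u} [Field k] {s s' : MarkedStage.{u}}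

/-- A stage under the Ω⁺ cycle invariant has a CLOSED `ν`-stratum (`ν` maximal: `X(ν) = X(≥ ν)`, CJS Lemma 2.36 over a field).
[cite: CossartJannsenSaito2020, Lemma 2.36] -/
theorem CycleInvPlus.isClosed_hsStratum (h : CycleInvPlus k N ν s) : IsClosed (Scheme.hsStratum s.W N ν) := by
  obtain ⟨f, hf, hq⟩ := h.overField
  rw [hsStratum_eq_hsStratumGE_of_supMax h.supMax]
  exact isClosed_hsStratumGE_over_field f h.dim_le ν

/-- The blow-up data of ONE Ω⁺ step under the invariant: closed strata with finitely many components, `π(X'(ν)) ⊆ X(ν)` (`H^N` does not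
increase along a permissible blow-up, `ν` maximal), strict transforms of subsets of `X(ν)` inside `X'(ν)`. [cite: CossartJannsenSaito2020, Rem. 6.29 (1), p. 92] -/
theorem CycleInvPlus.stepData (hω : OracleAdmissibleΩplus ω) (hν : ν ≠ iterPSum N Phi) (h : CycleInvPlus k N ν s)
    {C : s.W.IdealSheafData} {P' : Option (Pending (blowup C))} {hln : IsLocallyNoetherian (blowup C)} {x' : ↥(blowup C)}
    (hcs : IsCanonicalStepΩplus ω s.ln N ν s.L s.P C P')
    (h' : CycleInvPlus k N ν ⟨blowup C, hln, s.L.next (Scheme.hsStratum s.W N ν) C, P', x'⟩) :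
    IsClosed (Scheme.hsStratum s.W N ν) ∧ (componentsIn (Scheme.hsStratum s.W N ν)).Finite ∧
      IsClosed (Scheme.hsStratum (blowup C) N ν) ∧ (componentsIn (Scheme.hsStratum (blowup C) N ν)).Finite ∧
      (blowup.π C).base '' Scheme.hsStratum (blowup C) N ν ⊆ Scheme.hsStratum s.W N ν ∧
      ∀ T, T ⊆ Scheme.hsStratum s.W N ν →
        strictTransformSet (blowup.π C) (C.support : Set s.W) T ⊆ Scheme.hsStratum (blowup C) N ν := by
  haveI := s.ln
  haveI := hln
  haveI : IsNoetherian s.W := h.isNoetherian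
  haveI : IsNoetherian (blowup C) := h'.isNoetherian
  have hY : IsClosed (Scheme.hsStratum s.W N ν) := h.isClosed_hsStratum
  have hY' : IsClosed (Scheme.hsStratum (blowup C) N ν) := h'.isClosed_hsStratum
  obtain ⟨-, -, -, hmono⟩ := h.centre hω hν hcs
  refine ⟨hY, componentsIn.finite _, hY', componentsIn.finite _, ?_,
    fun T hT => strictTransformSet_subset_hsStratum C hT hY'⟩
  rintro _ ⟨z, hz, rfl⟩
  exact h.supMax _ ((Scheme.mem_hsStratum_iff.mp hz).symm.le.trans (hmono z))

/-- **THE PART INVARIANT PROPAGATES ALONG Ω⁺-STEPS**: if inside a cycle the replayed subscheme lies in the label part of the cycle's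
label, the same holds at the next state (cycle start: the replayed subscheme IS the least non-empty part; replay step: the next replayed
subscheme is the strict transform of the previous one, GW 13.96 (2), inside the strict transform of the part, inside the next part by
§1). [cite: CossartJannsenSaito2020, Rem. 6.29 (1), (6.5)–(6.7)] [cite: GortzWedhorn2020, Prop. 13.96 (2)] -/
theorem range_hom_subset_part_stepΩplus (hω : OracleAdmissibleΩplus ω) (hν : ν ≠ iterPSum N Phi) (h : CycleInvPlus k N ν s)
    (hp : ∀ Q, s.P = some Q → Set.range Q.hom.base ⊆ s.L.part (Scheme.hsStratum s.W N ν) Q.lbl)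
    (hst : CanonicalNearStepσ (Strategy.ofStageOraclePlus ω) N ν s s') :
    ∀ Q', s'.P = some Q' → Set.range Q'.hom.base ⊆ s'.L.part (Scheme.hsStratum s'.W N ν) Q'.lbl := by
  have h' : CycleInvPlus k N ν s' := h.step hω hν hst
  obtain ⟨C, P', hln, x', hcs, -, -, -, rfl⟩ := hst
  change IsCanonicalStepΩplus ω s.ln N ν s.L s.P C P' at hcs
  obtain ⟨hY, -, hY', hfin', hπY', hST⟩ := h.stepData hω hν hcs h'
  haveI := s.ln
  intro Q' hQ'
  change P' = some Q' at hQ'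
  show Set.range Q'.hom.base ⊆
    (s.L.next (Scheme.hsStratum s.W N ν) C).part (Scheme.hsStratum (blowup C) N ν) Q'.lbl
  -- the replay lemma (a step INSIDE a cycle), from «replayed subscheme ⊆ part»
  have replay : ∀ (j : ℕ) {S : Scheme.{u}} (φ : S ⟶ s.W) [IsClosedImmersion φ] (D : S.IdealSheafData)
      (t' : CentreSeq (blowup D)), Set.range φ.base ⊆ s.L.part (Scheme.hsStratum s.W N ν) j →
      IsReplayStep s.L (Scheme.hsStratum s.W N ν) j φ (CentreSeq.cons D t') C P' →
      Set.range Q'.hom.base ⊆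
        (s.L.next (Scheme.hsStratum s.W N ν) C).part (Scheme.hsStratum (blowup C) N ν) Q'.lbl := by
    intro j S φ _ D t' hrange hs
    obtain ⟨P'', hP'', hrange''⟩ := hs.range_hom_eq_strictTransformSet
    obtain ⟨-, φ', hφ', -, hsome⟩ := hs
    obtain rfl : P'' = Q' := Option.some_injective _ (hP''.symm.trans hQ')
    have hQ₀ : P'' = ⟨j, blowup D, φ', hφ', t'⟩ := Option.some_injective _ (hP''.symm.trans hsome)
    subst hQ₀
    rw [hrange'']
    exact (closure_mono (Set.preimage_mono (Set.sdiff_subset_sdiff_left hrange))).trans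
      (strictTransformSet_part_subset_next_part C s.L hY hY' hfin' hπY' hST j)
  rcases hsP : s.P with _ | Q
  · rw [hsP] at hcs
    obtain ⟨j, -, hcl, t, -, hrep⟩ := hcs
    cases t with
    | nil _ =>
      obtain ⟨-, hnone⟩ := hrep
      rw [hnone] at hQ'
      exact absurd hQ' (by simp)
    | cons D t' =>
      have hrep' : IsReplayStep s.L (Scheme.hsStratum s.W N ν) j _ (CentreSeq.cons D t') C P' := hrep
      refine replay j _ D t' ?_ hrep'
      rw [Scheme.IdealSheafData.range_subschemeι, Scheme.IdealSheafData.coe_support_vanishingIdeal]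
      exact subset_rfl
  · rw [hsP] at hcs
    obtain ⟨-, hrep⟩ := hcs
    haveI := Q.isClosedImmersion
    have hpQ := hp Q hsP
    generalize hr : Q.rest = r at hrep
    cases r with
    | nil _ =>
      obtain ⟨-, hnone⟩ := hrep
      rw [hnone] at hQ'
      exact absurd hQ' (by simp)
    | cons D t' =>
      have hrep' : IsReplayStep s.L (Scheme.hsStratum s.W N ν) Q.lbl Q.hom (CentreSeq.cons D t') C P' := hrep
      exact replay Q.lbl Q.hom D t' hpQ hrep'

/-- The part invariant propagates along `Reachesσ`. [folklore] -/
theorem range_hom_subset_part_of_reachesΩplus (hω : OracleAdmissibleΩplus ω) (hν : ν ≠ iterPSum N Phi)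
    (h : CycleInvPlus k N ν s)
    (hp : ∀ Q, s.P = some Q → Set.range Q.hom.base ⊆ s.L.part (Scheme.hsStratum s.W N ν) Q.lbl)
    (hr : Reachesσ (Strategy.ofStageOraclePlus ω) N ν s s') :
    ∀ Q', s'.P = some Q' → Set.range Q'.hom.base ⊆ s'.L.part (Scheme.hsStratum s'.W N ν) Q'.lbl := by
  induction hr with
  | refl => exact hp
  | tail hr' hlast ih => exact range_hom_subset_part_stepΩplus hω hν (h.of_reaches hω hν hr') ih hlast

/-- **THE PART INVARIANT ALONG AN Ω⁺-CHAIN FROM A MAXIMAL ORIGIN** (`ν ≠ Φ^{(N)}`, Ω⁺-admissible stage oracle): at every stage inside a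
cycle the replayed subscheme lies in the label part of the cycle's label. [cite: CossartJannsenSaito2020, Rem. 6.29 (1), (6.5)–(6.7)] -/
theorem range_hom_subset_part_chainΩplus {p : ℕ} (hω : OracleAdmissibleΩplus ω) (hν : ν ≠ iterPSum N Phi) {X : Scheme.{u}}
    [IsLocallyNoetherian X] {x : X} (hX : IsMaximalOrigin p N ν X x) {c : ℕ → MarkedStage.{u}}
    (h0 : Reachesσ (Strategy.ofStageOraclePlus ω) N ν (MarkedStage.init X x) (c 0))
    (hstep : ∀ n, CanonicalNearStepσ (Strategy.ofStageOraclePlus ω) N ν (c n) (c (n + 1))) (n : ℕ) :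
    ∀ Q, (c n).P = some Q → Set.range Q.hom.base ⊆ (c n).L.part (Scheme.hsStratum (c n).W N ν) Q.lbl := by
  obtain ⟨k, _, hinit⟩ := hX.exists_cycleInvPlus (N := N) (ν := ν)
  exact range_hom_subset_part_of_reachesΩplus hω hν hinit (fun Q hQ => by cases hQ) (reachesσ_chain h0 hstep n)

/-- **BIRTHS LIE OVER THE CENTRE, Ω⁺ form.** Under the Ω⁺ cycle invariant, along an Ω⁺-step read through its step projection
`f : X_{n+1} ⟶ X_n` with centre `C`: a component `Z'` of `X_{n+1}(ν)` dominating no component of `X_n(ν)` lies inside `f⁻¹(V(C))`.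
[cite: CossartJannsenSaito2020, Rem. 6.29 (1), p. 92] [cite: GortzWedhorn2020, Prop. 13.91 (3), (13.19) p. 414] -/
theorem StepProjectionσ.subset_preimage_support_of_not_mem_Ωplus (hω : OracleAdmissibleΩplus ω) (hν : ν ≠ iterPSum N Phi)
    (h : CycleInvPlus k N ν s) {f : s'.W ⟶ s.W} (hf : StepProjectionσ (Strategy.ofStageOraclePlus ω) N ν s s' f)
    {Z' : Set s'.W} (hZ' : Z' ∈ componentsIn (Scheme.hsStratum s'.W N ν))
    (hnot : closure (f.base '' Z') ∉ componentsIn (Scheme.hsStratum s.W N ν)) :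
    ∃ (C : s.W.IdealSheafData) (P' : Option (Pending (blowup C))), IsCanonicalStepΩplus ω s.ln N ν s.L s.P C P' ∧
      Z' ⊆ f.base ⁻¹' (C.support : Set s.W) := by
  have h' : CycleInvPlus k N ν s' := h.step hω hν hf.canonicalNearStepσ
  obtain ⟨C, P', hln, x', hcs, -, -, -, e, rfl⟩ := hf
  subst e
  change IsCanonicalStepΩplus ω s.ln N ν s.L s.P C P' at hcs
  refine ⟨C, P', hcs, ?_⟩
  simp only [eqToHom_refl, Category.id_comp] at hnot ⊢
  obtain ⟨hY, hfin, hY', hfin', hπY', hST⟩ := h.stepData hω hν hcs h'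
  exact subset_preimage_support_of_not_mem_componentsIn C hY hfin hY' hfin' hπY' hST hZ' hnot

/-- **A NEWBORN COMPONENT THROUGH THE CHAIN POINT FORCES A BLOWN-UP STAGE, Ω⁺ form** (`MarkedStage.IsBlownUpσ`).
[cite: CossartJannsenSaito2020, Rem. 6.29 (1), p. 92] -/
theorem isBlownUpσ_of_birth_Ωplus (hω : OracleAdmissibleΩplus ω) (hν : ν ≠ iterPSum N Phi) (h : CycleInvPlus k N ν s)
    {f : s'.W ⟶ s.W} (hf : StepProjectionσ (Strategy.ofStageOraclePlus ω) N ν s s' f) {Z' : Set s'.W}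
    (hZ' : Z' ∈ componentsThrough N ν s') (hnot : closure (f.base '' Z') ∉ componentsIn (Scheme.hsStratum s.W N ν)) :
    s.IsBlownUpσ (Strategy.ofStageOraclePlus ω) N ν := by
  obtain ⟨C, P', hcs, hsub⟩ := hf.subset_preimage_support_of_not_mem_Ωplus hω hν h hZ'.1 hnot
  refine ⟨C, P', hcs, ?_⟩
  have := hsub hZ'.2
  rwa [Set.mem_preimage, hf.base_pt] at this

/-- **THE Ω⁺ END CENTRE LIES IN THE TREATED PART** (functional stage oracle, part invariant inside the current cycle): at an Ω⁺-step
leading to a state BETWEEN cycles (`P = none` next) the centre is `V(range φ)` for the replayed subscheme `φ` (a cycle of positive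
length) or the whole least part (a cycle of length `0`); either way `V(C) ⊆ Y_n^{(j)}`, `j = treatedLabel`. Port of stub-4's
`support_eq_part_of_next_none` (p503069) with `=` weakened to `⊆`. [cite: CossartJannsenSaito2020, Rem. 6.29 (1), proof of Thm. 6.28 Step 7] -/
theorem support_subset_part_of_next_none_Ωplus (hωf : OracleFunctionalΩ ω)
    (hp : ∀ Q, s.P = some Q → Set.range Q.hom.base ⊆ s.L.part (Scheme.hsStratum s.W N ν) Q.lbl)
    (hst : CanonicalNearStepσ (Strategy.ofStageOraclePlus ω) N ν s s') (hnone : s'.P = none)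
    {C : s.W.IdealSheafData} {P' : Option (Pending (blowup C))} (hcs : IsCanonicalStepΩplus ω s.ln N ν s.L s.P C P') :
    (C.support : Set s.W) ⊆ s.L.part (Scheme.hsStratum s.W N ν) (treatedLabel N ν s) := by
  obtain ⟨C₀, P₀, hln, x', hcs₀, -, -, -, rfl⟩ := hst
  change IsCanonicalStepΩplus ω s.ln N ν s.L s.P C₀ P₀ at hcs₀
  change P₀ = none at hnone
  subst hnone
  obtain rfl : C = C₀ := hcs.centre_unique hωf hcs₀
  clear hcs
  rcases hsP : s.P with _ | Q
  · rw [treatedLabel_of_none hsP]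
    rw [hsP] at hcs₀
    obtain ⟨j, hj, hcl, t, -, hrep⟩ := hcs₀
    rw [hj.csInf_eq]
    cases t with
    | nil _ =>
      obtain ⟨⟨hc, hC⟩, -⟩ := hrep
      rw [hC, Scheme.IdealSheafData.coe_support_vanishingIdeal]
      show Set.range _ ⊆ _
      rw [Scheme.IdealSheafData.range_subschemeι, Scheme.IdealSheafData.coe_support_vanishingIdeal]
      exact subset_rfl
    | cons D t' =>
      obtain ⟨-, φ', hφ', -, hsome⟩ := (isReplayStepPlus_cons_iff _ _ _ _ D t' C none).mp hrep
      exact absurd hsome (by simp)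
  · rw [treatedLabel_of_some hsP]
    rw [hsP] at hcs₀
    obtain ⟨-, hrep⟩ := hcs₀
    have hpQ := hp Q hsP
    generalize hr : Q.rest = r at hrep
    cases r with
    | nil _ =>
      obtain ⟨⟨hc, hC⟩, -⟩ := hrep
      rw [hC, Scheme.IdealSheafData.coe_support_vanishingIdeal]
      exact hpQ
    | cons D t' =>
      obtain ⟨-, φ', hφ', -, hsome⟩ := (isReplayStepPlus_cons_iff _ _ _ _ D t' C none).mp hrep
      exact absurd hsome (by simp)

/-- **THE SANDWICH OF A MOVING BIRTH AT A BLOWN-UP Ω⁺ CYCLE-END STEP** (port of res-type-040's `IsMovingBirthAt.exists_host`, p517068, to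
Ω⁺; functional Ω⁺-admissible stage oracle, `ν ≠ Φ^{(N)}`, Ω⁺ cycle invariant and part invariant at `X_n`). At an Ω⁺-step into a state
between cycles, a MOVING BIRTH `Z' ∋ x_{n+1}` has `B = closure f(Z')` inside ONE component `S ∋ x_n` of `X_n(ν)` OF THE TREATED LABEL,
with `{x_n} ⊊ B ⊊ S` — the host has depth `≥ 2` at `x_n`. (The CJS clause «`S ⊆ V(C)`» is dropped: an Ω⁺ END centre is the strict
transform of the part through the cycle, which need not contain whole components dominated after being swallowed.)
[cite: CossartJannsenSaito2020, Rem. 6.29 (1), p. 92] -/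
theorem _root_.Summit.ResolutionOfSingularities.ResolutionOfSingularities.Theorems.SigmaMaxModificationsCorridor3.Moving.IsMovingBirthAt.exists_host_Ωplus
    (hωf : OracleFunctionalΩ ω) (hω : OracleAdmissibleΩplus ω) (hν : ν ≠ iterPSum N Phi) (h : CycleInvPlus k N ν s)
    (hp : ∀ Q, s.P = some Q → Set.range Q.hom.base ⊆ s.L.part (Scheme.hsStratum s.W N ν) Q.lbl)
    (hst : CanonicalNearStepσ (Strategy.ofStageOraclePlus ω) N ν s s') (hnone : s'.P = none) {f : s'.W ⟶ s.W}
    (hf : StepProjectionσ (Strategy.ofStageOraclePlus ω) N ν s s' f) {Z' : Set s'.W} (hZ' : IsMovingBirthAt N ν s s' f Z') :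
    ∃ S ∈ componentsThrough N ν s, s.L.label S = treatedLabel N ν s ∧
      closure (f.base '' Z') ⊆ S ∧ closure (f.base '' Z') ≠ S ∧ HasSandwichAt s S := by
  obtain ⟨⟨hZ'c, hnot⟩, hne⟩ := hZ'
  haveI := s.ln
  haveI : IsNoetherian s.W := h.isNoetherian
  -- births lie over the centre, and the END centre lies in the treated part
  obtain ⟨C, P', hcs, hsub⟩ := hf.subset_preimage_support_of_not_mem_Ωplus hω hν h hZ'c.1 hnot
  have hsupp : (C.support : Set s.W) ⊆ s.L.part (Scheme.hsStratum s.W N ν) (treatedLabel N ν s) :=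
    support_subset_part_of_next_none_Ωplus hωf hp hst hnone hcs
  -- the image closure `B`
  set B : Set s.W := closure (f.base '' Z') with hB
  have hBirr : IsIrreducible B :=
    ((componentsIn.isIrreducible hZ'c.1).image _ f.base.hom.continuous.continuousOn).closure
  have hBC : B ⊆ (C.support : Set s.W) :=
    closure_minimal (Set.image_subset_iff.mpr hsub) C.support.isClosed
  have hxB : s.pt ∈ B := subset_closure ⟨s'.pt, hZ'c.2, hf.base_pt⟩
  -- `B` lies in ONE component `S` of the treated label
  have hY : IsClosed (Scheme.hsStratum s.W N ν) := h.isClosed_hsStratum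
  let 𝒮 : Set (Set s.W) := {Z | Z ∈ componentsIn (Scheme.hsStratum s.W N ν) ∧ s.L.label Z = treatedLabel N ν s}
  have h𝒮fin : 𝒮.Finite := (componentsIn.finite _).subset fun _ hZ => hZ.1
  have hBcov : B ⊆ ⋃₀ (h𝒮fin.toFinset : Set (Set s.W)) := by
    intro b hb
    have hb' : b ∈ s.L.part (Scheme.hsStratum s.W N ν) (treatedLabel N ν s) := hsupp (hBC hb)
    obtain ⟨Z, hZ, hl, hbZ⟩ := (s.L.mem_part_iff _ _ _).mp hb'
    exact ⟨Z, h𝒮fin.mem_toFinset.mpr ⟨hZ, hl⟩, hbZ⟩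
  obtain ⟨S, hS, hBS⟩ := isIrreducible_iff_sUnion_isClosed.mp hBirr h𝒮fin.toFinset
    (fun Z hZ => componentsIn.isClosed hY (h𝒮fin.mem_toFinset.mp hZ).1) hBcov
  obtain ⟨hSc, hSl⟩ := h𝒮fin.mem_toFinset.mp hS
  have hxS : s.pt ∈ S := hBS hxB
  have hBneS : B ≠ S := fun hBS' => hnot (hBS' ▸ hSc)
  exact ⟨S, ⟨hSc, hxS⟩, hSl, hBS, hBneS, ⟨B, hBirr, isClosed_closure, hxB, hBS, hne, hBneS⟩⟩

/-- **NO MOVING BIRTH OVER TREATED COMPONENTS OF DEPTH ≤ 1, Ω⁺ form** (port of `not_isMovingBirthAt_of_forall_not_hasSandwichAt`,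
p517068): if no component of `X_n(ν)` through `x_n` of the treated label has depth `≥ 2` at `x_n`, there is no moving birth through
`x_{n+1}` at an Ω⁺ cycle-end step. [cite: CossartJannsenSaito2020, Rem. 6.29 (1), p. 92] -/
theorem not_isMovingBirthAt_of_forall_not_hasSandwichAt_Ωplus (hωf : OracleFunctionalΩ ω) (hω : OracleAdmissibleΩplus ω)
    (hν : ν ≠ iterPSum N Phi) (h : CycleInvPlus k N ν s)
    (hp : ∀ Q, s.P = some Q → Set.range Q.hom.base ⊆ s.L.part (Scheme.hsStratum s.W N ν) Q.lbl)
    (hst : CanonicalNearStepσ (Strategy.ofStageOraclePlus ω) N ν s s') (hnone : s'.P = none) {f : s'.W ⟶ s.W}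
    (hf : StepProjectionσ (Strategy.ofStageOraclePlus ω) N ν s s' f)
    (hcurve : ∀ S ∈ componentsThrough N ν s, s.L.label S = treatedLabel N ν s → ¬ HasSandwichAt s S) (Z' : Set s'.W) :
    ¬ IsMovingBirthAt N ν s s' f Z' := by
  intro hZ'
  obtain ⟨S, hS, hSl, -, -, hsand⟩ := hZ'.exists_host_Ωplus hωf hω hν h hp hst hnone hf
  exact hcurve S hS hSl hsand

end Omega

end Summit.ResolutionOfSingularities.ResolutionOfSingularities.Theorems.SigmaMaxModificationsCorridor3.Sigma

end
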